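import Summits.CriticalPhenomena.PercolationContinuityZ3.Theses.PercNonProliferation
import Summits.CriticalPhenomena.PercolationContinuityZ3.Theorems.PercNonProliferationNonProliferationFewClasses
import HarnessLib

/-!
# TenureSketch — the WEAKEST class-type item that closes route `PercNonProliferation` (strategist s1, census §Decomposition 2(a), §6.2)

`DominantClass` ("bounded Cauchy–Schwarz defect of the percolating set"): at `p_c(ℤ³)` there are `M` and `c > 0` such that
for infinitely many `n`, with probability `≥ c`,
`(#{x ∈ B(n) : x ↔ ∞})² ≤ M · #{(x,y) ∈ B(n)² : x ↔ y inside B(2n)}`.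
Pointwise this says the largest `B(2n)`-class of percolating points of `B(n)` holds `≥ 1/M` of them (up to the factor between
`Σ_r v_r²` and `v_max · V`), i.e. "the critical infinite cluster, if any, does not shatter into `o(1)`-fraction classes at ratio 2".
It is EXACTLY the hypothesis `hG`/`hcount` consumed by the landed abstract assembly `nonProlifAssembly_abstract`, hence:

* `dominantClass_of_fewClasses` — child S1 (`InfiniteClusterFewClasses`) ⟹ `DominantClass` (landed counting lemma, pointwise);
* `continuity_of_freeBoxSparse_of_dominantClass` — `FreeBoxSparse → DominantClass → θ(p_c(ℤ³)) = 0` (the FewClasses proof with the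
  counting step replaced by the hypothesis itself).

So `S ⟹ S1 ⟹ DominantClass ⟹ (FreeBoxSparse → S)`: DominantClass sits between S1 and the route's own `closes`; it is the weakest target an
ideation seat on this route can be given. Sorry-free; for the TENURE planner (a strategist files no route items). Namespace is local to the
crux dir so nothing clashes with future route decls.
-/

noncomputable section

namespace Summit.CriticalPhenomena.PercolationContinuityZ3.Cruxes.NonProliferation.TenureSketch

open scoped Classical
open MeasureTheory Filter Topology
open Literature.Probability.LatticeModels Literature.Probability.Percolation
open Summit.CriticalPhenomena.PercolationContinuityZ3.Theses.PercNonProliferation (FreeBoxSparse)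
open Summit.CriticalPhenomena.PercolationContinuityZ3.Theorems
open Summit.CriticalPhenomena.PercolationContinuityZ3.Theorems.NonProliferation

/-- **DominantClass** (route-file spelling would be fully qualified; here with the usual `open`s). -/
def DominantClass : Prop :=
  ∃ (M : ℕ) (c : ℝ), 0 < c ∧ ∃ᶠ n : ℕ in atTop, c ≤ (bondPercolation (zdGraph 3) (criticalProbI 3)).real
    {ω | ((((box 3 n).filter fun x => ω ∈ percolatesAt x).card : ℕ) : ℝ) ^ 2 ≤
      M * ((((box 3 n ×ˢ box 3 n).filter fun q => ω ∈ openConnIn (↑(box 3 (2 * n)) : Set (Site 3)) q.1 q.2).card : ℕ) : ℝ)}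

/-- Child S1 of the split, spelled as filed. -/
def InfiniteClusterFewClasses : Prop :=
  ∃ (M : ℕ) (c : ℝ), 0 < c ∧ ∃ᶠ n : ℕ in atTop, c ≤ (bondPercolation (zdGraph 3) (criticalProbI 3)).real
    {ω | ¬ ∃ x : Fin (M + 1) → Site 3, (∀ i, x i ∈ box 3 n) ∧ (∀ i, ω ∈ percolatesAt (x i)) ∧
      ∀ i j, i ≠ j → ω ∉ openConnIn (↑(box 3 (2 * n)) : Set (Site 3)) (x i) (x j)}

/-- **S1 ⟹ DominantClass**, pointwise inclusion of events via the landed counting lemma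
`sq_card_le_mul_card_filter_of_not_exists` (no almost-sure argument needed). -/
theorem dominantClass_of_fewClasses (h : InfiniteClusterFewClasses) : DominantClass := by
  obtain ⟨M, c, hc, hfreq⟩ := h
  refine ⟨M, c, hc, hfreq.mono fun n hn => hn.trans ?_⟩
  refine measureReal_mono (fun ω hω => ?_) (measure_ne_top _ _)
  have hsub : box 3 n ⊆ box 3 (2 * n) := box_mono 3 (by omega)
  have hcount := sq_card_le_mul_card_filter_of_not_exists (box 3 n)
    ((box 3 n).filter fun x => ω ∈ percolatesAt x)
    (fun x y => ω ∈ openConnIn (↑(box 3 (2 * n)) : Set (Site 3)) x y)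
    (fun x => ω ∈ percolatesAt x) M (Finset.filter_subset _ _) ?_ ?_ ?_ ?_ hω
  · exact_mod_cast hcount
  · intro x hx
    have hxS : x ∈ (↑(box 3 (2 * n)) : Set (Site 3)) :=
      Finset.mem_coe.2 (hsub (Finset.mem_filter.1 hx).1)
    exact ⟨hxS, hxS, SimpleGraph.Reachable.refl _⟩
  · rintro x y ⟨hx, hy, h⟩
    exact ⟨hy, hx, h.symm⟩
  · rintro x y z ⟨hx, hy, h⟩ ⟨_, hz, h'⟩
    exact ⟨hx, hz, h.trans h'⟩
  · intro x hx
    exact (Finset.mem_filter.1 hx).2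

/-- **The route closes on DominantClass**: `FreeBoxSparse → DominantClass → θ(p_c(ℤ³)) = 0`
(the proof of `continuity_of_freeBoxSparse_of_fewClasses`, p145974, with the counting step replaced by the hypothesis). -/
theorem continuity_of_freeBoxSparse_of_dominantClass (hSparse : FreeBoxSparse) (hDom : DominantClass) :
    _root_.PercolationContinuityZ3 := by
  unfold FreeBoxSparse at hSparse
  refine Literature.Probability.Percolation.percolationContinuityZ3_iff.2 ?_
  by_contra hne
  have theta_nonneg : 0 ≤ theta (zdGraph 3) (0 : Site 3) (criticalProbI 3) := by
    unfold theta
    exact measureReal_nonneg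
  have hθ : 0 < theta (zdGraph 3) (0 : Site 3) (criticalProbI 3) := lt_of_le_of_ne theta_nonneg (Ne.symm hne)
  obtain ⟨M, c, hc, hfreq⟩ := hDom
  have hD := densityWhp_proof (criticalProbI 3)
  have hK : ∀ n : ℕ, (0 : ℝ) < ((box 3 n).card : ℝ) := fun n =>
    Nat.cast_pos.2 (Finset.card_pos.2 (box_nonempty 3 n))
  have hA : (bondPercolation (zdGraph 3) (criticalProbI 3)).real (Set.univ : Set (BondConfig (Site 3)))ᶜ = 0 := by
    simp
  have hVm : ∀ n : ℕ, Measurable fun ω : BondConfig (Site 3) =>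
      ((((box 3 n).filter fun x => ω ∈ percolatesAt x).card : ℕ) : ℝ) := fun n =>
    nonProlifAssembly_measurable_card_filter (box 3 n) (fun x => percolatesAt x)
      (fun x => measurableSet_percolatesAt_holds x)
  have hSI : ∀ n : ℕ, Integrable (fun ω : BondConfig (Site 3) =>
      ((((box 3 n ×ˢ box 3 n).filter fun q => ω ∈ openConnIn ↑(box 3 (2 * n)) q.1 q.2).card : ℕ) : ℝ))
        (bondPercolation (zdGraph 3) (criticalProbI 3)) ∧
      ∫ ω, ((((box 3 n ×ˢ box 3 n).filter fun q => ω ∈ openConnIn ↑(box 3 (2 * n)) q.1 q.2).card : ℕ) : ℝ)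
        ∂(bondPercolation (zdGraph 3) (criticalProbI 3)) =
      ∑ q ∈ box 3 n ×ˢ box 3 n, (bondPercolation (zdGraph 3) (criticalProbI 3)).real
        (openConnIn ↑(box 3 (2 * n)) q.1 q.2) := fun n =>
    nonProlifAssembly_integral_card_filter (bondPercolation (zdGraph 3) (criticalProbI 3)) (box 3 n ×ˢ box 3 n)
      (fun q : Site 3 × Site 3 => openConnIn (↑(box 3 (2 * n)) : Set (Site 3)) q.1 q.2)
      (fun q => measurableSet_openConnIn_of_countable _ _ _)
  have h2n : Tendsto (fun n : ℕ => 2 * n) atTop atTop :=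
    tendsto_atTop_mono (fun n : ℕ => show n ≤ 2 * n by omega) tendsto_id
  have hu : Tendsto (fun n : ℕ => 64 * ((∑ x ∈ box 3 (2 * n), ∑ y ∈ box 3 (2 * n),
      (bondPercolation (zdGraph 3) (criticalProbI 3)).real (openConnIn ↑(box 3 (2 * n)) x y)) /
        ((box 3 (2 * n)).card : ℝ) ^ 2)) atTop (𝓝 0) := by
    have h := (hSparse.comp h2n).const_mul 64
    rw [mul_zero] at h
    exact h
  have hES : ∀ n : ℕ,
      ∫ ω, ((((box 3 n ×ˢ box 3 n).filter fun q => ω ∈ openConnIn ↑(box 3 (2 * n)) q.1 q.2).card : ℕ) : ℝ)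
        ∂(bondPercolation (zdGraph 3) (criticalProbI 3)) ≤
      64 * ((∑ x ∈ box 3 (2 * n), ∑ y ∈ box 3 (2 * n),
        (bondPercolation (zdGraph 3) (criticalProbI 3)).real (openConnIn ↑(box 3 (2 * n)) x y)) /
          ((box 3 (2 * n)).card : ℝ) ^ 2) * ((box 3 n).card : ℝ) ^ 2 := by
    intro n
    rw [(hSI n).2, Finset.sum_product]
    have hT0 : 0 ≤ ∑ x ∈ box 3 (2 * n), ∑ y ∈ box 3 (2 * n),
        (bondPercolation (zdGraph 3) (criticalProbI 3)).real (openConnIn ↑(box 3 (2 * n)) x y) :=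
      Finset.sum_nonneg fun x _ => Finset.sum_nonneg fun y _ => measureReal_nonneg
    have hc2 : ((box 3 (2 * n)).card : ℝ) ^ 2 ≠ 0 := (pow_pos (hK (2 * n)) 2).ne'
    calc ∑ x ∈ box 3 n, ∑ y ∈ box 3 n,
          (bondPercolation (zdGraph 3) (criticalProbI 3)).real (openConnIn ↑(box 3 (2 * n)) x y)
        ≤ ∑ x ∈ box 3 (2 * n), ∑ y ∈ box 3 (2 * n),
          (bondPercolation (zdGraph 3) (criticalProbI 3)).real (openConnIn ↑(box 3 (2 * n)) x y) :=
          polynomialAssembly_sum_sum_mono (box_mono 3 (by omega)) fun x y => measureReal_nonneg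
      _ = (∑ x ∈ box 3 (2 * n), ∑ y ∈ box 3 (2 * n),
          (bondPercolation (zdGraph 3) (criticalProbI 3)).real (openConnIn ↑(box 3 (2 * n)) x y)) /
            ((box 3 (2 * n)).card : ℝ) ^ 2 * ((box 3 (2 * n)).card : ℝ) ^ 2 :=
          (div_mul_cancel₀ _ hc2).symm
      _ ≤ (∑ x ∈ box 3 (2 * n), ∑ y ∈ box 3 (2 * n),
          (bondPercolation (zdGraph 3) (criticalProbI 3)).real (openConnIn ↑(box 3 (2 * n)) x y)) /
            ((box 3 (2 * n)).card : ℝ) ^ 2 * (64 * ((box 3 n).card : ℝ) ^ 2) :=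
          mul_le_mul_of_nonneg_left (nonProlifAssembly_card_box_two_mul_sq_le n) (div_nonneg hT0 (sq_nonneg _))
      _ = _ := by ring
  have hS : ∀ δ : ℝ, 0 < δ → Tendsto (fun n : ℕ => (bondPercolation (zdGraph 3) (criticalProbI 3)).real
      {ω : BondConfig (Site 3) | δ * ((box 3 n).card : ℝ) ^ 2 ≤
        ((((box 3 n ×ˢ box 3 n).filter fun q => ω ∈ openConnIn ↑(box 3 (2 * n)) q.1 q.2).card : ℕ) : ℝ)})
      atTop (𝓝 0) := fun δ hδ =>
    nonProlifAssembly_markov (bondPercolation (zdGraph 3) (criticalProbI 3)) hK (fun n ω => Nat.cast_nonneg _)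
      (fun n => (hSI n).1) hES hu hδ
  refine nonProlifAssembly_abstract (bondPercolation (zdGraph 3) (criticalProbI 3)) (M := M) hθ hc hK hA hfreq
    (V := fun n ω => ((((box 3 n).filter fun x => ω ∈ percolatesAt x).card : ℕ) : ℝ)) ?_
    (fun n => measurableSet_le measurable_const (hVm n)) hD hS
  intro n ω _ hωG
  exact hωG

/-- DominantClass is a consequence of the summit (through S1). -/
theorem dominantClass_of_continuity (h : _root_.PercolationContinuityZ3) : DominantClass :=
  dominantClass_of_fewClasses (infiniteClusterFewClasses_of_continuity h)

end Summit.CriticalPhenomena.PercolationContinuityZ3.Cruxes.NonProliferation.TenureSketch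

end
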